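import Literature.AnabelianGeometry.AbsoluteAnabelian.ArchimedeanHolFieldFunctorGeometricPSLNormalizerFinite
import Literature.AnabelianGeometry.AbsoluteAnabelian.ArchimedeanHolFieldFunctorGeometricPSLCuspStabilizer
import HarnessLib

/-!
# `[N_{PSL₂(ℝ)}(Γ̄) : Γ̄] < ∞` for a properly discontinuous `Γ̄` with finitely many cusp classes

Classical input for [AbsTopIII] Prop 4.2 (i) (S. Mochizuki, *Topics in Absolute Anabelian Geometry
III*, proof of Proposition 4.2 (i), p. 106: the RC/holomorphic automorphisms of `ℍ/Γ̄` over the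
uniformised hyperbolic curve form the FINITE group `N_{PSL₂(ℝ)}(Γ̄)/Γ̄`), in the PUNCTURED case — the
curves `X_v` of [IUTchI–III] are punctured, so `ℍ/Γ̄` is NOT compact and abc-iut-L4-d1's compact-case
theorem `finiteIndex_subgroupOf_normalizer_of_compactSpace` does not apply.  Here the finiteness is
derived ALGEBRAICALLY from the cusps (Farkas–Kra IV.5–IV.6, Shimura §1.5): hypotheses

* (P) `Γ̄` contains a parabolic element (a lift `t ∈ SL(2, ℝ)` with `Matrix.IsParabolic ↑t`);
* (FC) finitely many `Γ̄`-classes of cusps — typed linear-algebraically, with NO boundary of `ℍ`: a cusp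
  is an eigenline `ℝ v` in `ℝ²` of a parabolic element of the preimage `Γ̃ ≤ SL(2, ℝ)`, and (FC) says
  that a finite set `F` of vectors represents them all up to `Γ̃` (the `(g, r)` datum of the consumer:
  `r ≥ 1` cusps);
* `Γ̄` properly discontinuous on `ℍ` and non-abelian (so `Ñ := π⁻¹ N(Γ̄)` is DISCRETE — the tree's
  `discreteTopology_comap_psl_normalizer`).

Proof (`finiteIndex_subgroupOf_normalizer_of_cusps`): `Ñ` permutes the cusp lines; the stabiliser
`S̃ ≤ Ñ` of the cusp line `ℝ v₀` of a parabolic `t₀ ∈ Γ̃` is, after conjugating `v₀` to `e₁`, a discrete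
upper-triangular group containing the parabolic `t₀`, so `⟨t₀⟩` — hence `S̃ ∩ Γ̃` — has finite index
in it (the brick `finiteIndex_zpowers_of_upperTriangular_discrete_of_isParabolic`); by (FC) every
`n ∈ Ñ` lies in `Γ̃ · m_w · S̃` for one of finitely many `m_w` (`w ∈ F`); so `Ñ` is a finite union of
`Γ̃`-cosets.  PROOF-ONLY file (abc-iut cell, row «J2i-CUSPED», seat abc-iut-L4-d1): no definitions, no
named facts.  HONEST FRAMING: classical, MODEL side of [AbsTopIII] §4 only; nothing here bears on
[IUTchIII] Cor. 3.12; model ≠ reconstruction.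
-/

noncomputable section

open scoped UpperHalfPlane MatrixGroups Matrix Topology
open _root_.MulAction

namespace Literature.AnabelianGeometry.AbsoluteAnabelian

namespace HolRS

/-! ### Linear algebra of `SL(2, ℝ)` acting on `ℝ²` -/

/-- `s⁻¹ (s v) = v` for `s ∈ SL(2, ℝ)` acting on `ℝ²`. [cite: FarkasKra1992, IV.5.6] -/
private theorem inv_mulVec_mulVec (s : SL(2, ℝ)) (v : Fin 2 → ℝ) :
    ((s⁻¹ : SL(2, ℝ)) : Matrix (Fin 2) (Fin 2) ℝ) *ᵥ ((s : Matrix (Fin 2) (Fin 2) ℝ) *ᵥ v) = v := by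
  rw [Matrix.mulVec_mulVec, ← Matrix.SpecialLinearGroup.coe_mul, inv_mul_cancel,
    Matrix.SpecialLinearGroup.coe_one, Matrix.one_mulVec]

/-- `s v ≠ 0` for `v ≠ 0`. [cite: FarkasKra1992, IV.5.6] -/
private theorem mulVec_ne_zero (s : SL(2, ℝ)) {v : Fin 2 → ℝ} (hv : v ≠ 0) :
    (s : Matrix (Fin 2) (Fin 2) ℝ) *ᵥ v ≠ 0 := by
  intro h
  apply hv
  rw [← inv_mulVec_mulVec s v, h, Matrix.mulVec_zero]

/-- The matrix inverse of `↑s` is `↑(s⁻¹)`. [cite: FarkasKra1992, IV.5.6] -/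
private theorem coe_inv_eq_inv (s : SL(2, ℝ)) :
    ((s⁻¹ : SL(2, ℝ)) : Matrix (Fin 2) (Fin 2) ℝ) = (s : Matrix (Fin 2) (Fin 2) ℝ)⁻¹ := by
  rw [Matrix.SpecialLinearGroup.coe_inv, Matrix.inv_def, Matrix.SpecialLinearGroup.det_coe,
    Ring.inverse_one, one_smul]

/-- Parabolicity is invariant under conjugation in `SL(2, ℝ)`. [cite: FarkasKra1992, IV.5.6] -/
private theorem isParabolic_conj_sl (n t : SL(2, ℝ)) (ht : (t : Matrix (Fin 2) (Fin 2) ℝ).IsParabolic) :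
    ((n * t * n⁻¹ : SL(2, ℝ)) : Matrix (Fin 2) (Fin 2) ℝ).IsParabolic := by
  rw [Matrix.SpecialLinearGroup.coe_mul, Matrix.SpecialLinearGroup.coe_mul, coe_inv_eq_inv]
  exact (Matrix.isParabolic_conj_iff (Matrix.SpecialLinearGroup.toGL n)).mpr ht

/-- If `t v = c v` then `(n t n⁻¹) (n v) = c (n v)`. [cite: FarkasKra1992, IV.5.6] -/
private theorem conj_mulVec_eq (n t : SL(2, ℝ)) {v : Fin 2 → ℝ} {c : ℝ}
    (h : (t : Matrix (Fin 2) (Fin 2) ℝ) *ᵥ v = c • v) :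
    ((n * t * n⁻¹ : SL(2, ℝ)) : Matrix (Fin 2) (Fin 2) ℝ) *ᵥ ((n : Matrix (Fin 2) (Fin 2) ℝ) *ᵥ v) =
      c • ((n : Matrix (Fin 2) (Fin 2) ℝ) *ᵥ v) := by
  rw [Matrix.mulVec_mulVec, ← Matrix.SpecialLinearGroup.coe_mul, inv_mul_cancel_right,
    Matrix.SpecialLinearGroup.coe_mul, ← Matrix.mulVec_mulVec, h, Matrix.mulVec_smul]

/-- A parabolic `2 × 2` real matrix has an eigenvector (`t = a + n`, `n ≠ 0`, `n² = 0`: any non-zero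
vector in the image of `n`). [cite: FarkasKra1992, IV.5.6] -/
private theorem exists_eigenvector_of_isParabolic {t : Matrix (Fin 2) (Fin 2) ℝ} (ht : t.IsParabolic) :
    ∃ v : Fin 2 → ℝ, v ≠ 0 ∧ ∃ c : ℝ, t *ᵥ v = c • v := by
  obtain ⟨a, n, htn, hn0, hnsq⟩ := Matrix.isParabolic_iff_exists.mp ht
  obtain ⟨w, hw⟩ : ∃ w : Fin 2 → ℝ, n *ᵥ w ≠ 0 := by
    by_contra hall
    push Not at hall
    apply hn0
    ext i j
    fin_cases j
    · have := congrFun (hall ![1, 0]) i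
      simpa [Matrix.mulVec, dotProduct, Fin.sum_univ_two] using this
    · have := congrFun (hall ![0, 1]) i
      simpa [Matrix.mulVec, dotProduct, Fin.sum_univ_two] using this
  refine ⟨n *ᵥ w, hw, a, ?_⟩
  rw [Matrix.mulVec_mulVec, htn, Matrix.add_mul, ← sq, hnsq, add_zero, Matrix.scalar_apply,
    ← Matrix.smul_eq_diagonal_mul, Matrix.smul_mulVec]

/-- `SL(2, ℝ)` moves `e₁` to any non-zero vector. [cite: FarkasKra1992, IV.5.6] -/
private theorem exists_sl_mulVec_eq (v : Fin 2 → ℝ) (hv : v ≠ 0) :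
    ∃ A : SL(2, ℝ), (A : Matrix (Fin 2) (Fin 2) ℝ) *ᵥ ![1, 0] = v := by
  by_cases h0 : v 0 = 0
  · have h1 : v 1 ≠ 0 := by
      intro h1
      apply hv
      ext i
      fin_cases i
      · exact h0
      · exact h1
    refine ⟨⟨!![v 0, -(v 1)⁻¹; v 1, 0], by simp [Matrix.det_fin_two_of, h1]⟩, ?_⟩
    ext i
    fin_cases i <;> simp [Matrix.mulVec, dotProduct, Fin.sum_univ_two]
  · refine ⟨⟨!![v 0, 0; v 1, (v 0)⁻¹], by simp [Matrix.det_fin_two_of, h0]⟩, ?_⟩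
    ext i
    fin_cases i <;> simp [Matrix.mulVec, dotProduct, Fin.sum_univ_two]

/-- If `A e₁ = v` and `s v = c v`, then `A⁻¹ s A` is upper triangular with entry `(0, 0)` equal to `c`.
[cite: FarkasKra1992, IV.5.6] -/
private theorem conj_upper_of_mulVec_eq (A s : SL(2, ℝ)) {v : Fin 2 → ℝ}
    (hA : (A : Matrix (Fin 2) (Fin 2) ℝ) *ᵥ ![1, 0] = v) {c : ℝ}
    (hs : (s : Matrix (Fin 2) (Fin 2) ℝ) *ᵥ v = c • v) :
    ((A⁻¹ * s * A : SL(2, ℝ)) : Matrix (Fin 2) (Fin 2) ℝ) 1 0 = 0 ∧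
      ((A⁻¹ * s * A : SL(2, ℝ)) : Matrix (Fin 2) (Fin 2) ℝ) 0 0 = c := by
  have hcol : ((A⁻¹ * s * A : SL(2, ℝ)) : Matrix (Fin 2) (Fin 2) ℝ) *ᵥ ![1, 0] = c • ![(1 : ℝ), 0] := by
    rw [Matrix.SpecialLinearGroup.coe_mul, Matrix.SpecialLinearGroup.coe_mul, ← Matrix.mulVec_mulVec,
      ← Matrix.mulVec_mulVec, hA, hs, Matrix.mulVec_smul, ← hA, inv_mulVec_mulVec]
  have key : ∀ i, ((A⁻¹ * s * A : SL(2, ℝ)) : Matrix (Fin 2) (Fin 2) ℝ) i 0 = (c • ![(1 : ℝ), 0]) i := by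
    intro i
    rw [← hcol]
    simp [Matrix.mulVec, dotProduct, Fin.sum_univ_two]
  exact ⟨by simpa using key 1, by simpa using key 0⟩

/-! ### The theorem -/

variable (Γ : Subgroup PSL2R)

/-- **`[N_{PSL₂(ℝ)}(Γ̄) : Γ̄] < ∞` in the cusped case.**  Let `Γ̄ ≤ PSL₂(ℝ)` act properly
discontinuously on `ℍ` and be non-abelian; write `π : SL(2, ℝ) → PSL₂(ℝ)`.  Assume (P): some lift
`t ∈ π⁻¹Γ̄` is parabolic, and (FC): there is a finite set `F ⊆ ℝ²` such that for every parabolic lift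
`t ∈ π⁻¹Γ̄` and every eigenvector `v ≠ 0` of `t` (a cusp of `Γ̄`), some lift `g ∈ π⁻¹Γ̄` maps `v` to a
multiple of some `w ∈ F` (finitely many `Γ̄`-classes of cusps).  Then `Γ̄` has finite index in its
normaliser — i.e. `Aut(ℍ/Γ̄) = N(Γ̄)/Γ̄` is finite for the uniformising group of a PUNCTURED hyperbolic
Riemann surface of finite type. [cite: MochizukiAbsTopIII2015, Proposition 4.2 (i) proof p.106]
[cite: FarkasKra1992, IV.5.6] -/
theorem finiteIndex_subgroupOf_normalizer_of_cusps [ProperlyDiscontinuousSMul Γ ℍ]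
    (hΓ : ∃ x y : Γ, x * y ≠ y * x)
    (hP : ∃ t : SL(2, ℝ), QuotientGroup.mk' (Subgroup.center SL(2, ℝ)) t ∈ Γ ∧
      (t : Matrix (Fin 2) (Fin 2) ℝ).IsParabolic)
    (hFC : ∃ F : Finset (Fin 2 → ℝ), ∀ t : SL(2, ℝ),
      QuotientGroup.mk' (Subgroup.center SL(2, ℝ)) t ∈ Γ → (t : Matrix (Fin 2) (Fin 2) ℝ).IsParabolic →
      ∀ v : Fin 2 → ℝ, v ≠ 0 → (∃ c : ℝ, (t : Matrix (Fin 2) (Fin 2) ℝ) *ᵥ v = c • v) →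
      ∃ g : SL(2, ℝ), QuotientGroup.mk' (Subgroup.center SL(2, ℝ)) g ∈ Γ ∧ ∃ w ∈ F, ∃ c : ℝ,
        (g : Matrix (Fin 2) (Fin 2) ℝ) *ᵥ v = c • w) :
    (Γ.subgroupOf (Subgroup.normalizer (Γ : Set PSL2R))).FiniteIndex := by
  classical
  set N : Subgroup PSL2R := Subgroup.normalizer (Γ : Set PSL2R) with hNdef
  let π : SL(2, ℝ) →* PSL2R := QuotientGroup.mk' (Subgroup.center SL(2, ℝ))
  set Nt : Subgroup SL(2, ℝ) := N.comap π with hNt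
  set Gt : Subgroup SL(2, ℝ) := Γ.comap π with hGt
  haveI : DiscreteTopology Nt := discreteTopology_comap_psl_normalizer Γ hΓ
  have hGtmem : ∀ x, x ∈ Gt ↔ π x ∈ Γ := fun x => Iff.rfl
  have hNtmem : ∀ x, x ∈ Nt ↔ π x ∈ N := fun x => Iff.rfl
  have hGN : Gt ≤ Nt := fun x hx => by
    rw [hNtmem]
    exact Subgroup.le_normalizer ((hGtmem x).mp hx)
  -- `Ñ` normalises `Γ̃`
  have hnorm : ∀ x ∈ Nt, ∀ γ ∈ Gt, x⁻¹ * γ * x ∈ Gt := by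
    intro x hx γ hγ
    rw [hGtmem] at hγ ⊢
    rw [map_mul, map_mul, map_inv]
    exact (Subgroup.mem_normalizer_iff''.mp ((hNtmem x).mp hx) (π γ)).mp hγ
  -- the data
  obtain ⟨t₀, ht₀Γ, ht₀par⟩ := hP
  have ht₀G : t₀ ∈ Gt := (hGtmem t₀).mpr ht₀Γ
  obtain ⟨v₀, hv₀, c₀, hc₀⟩ := exists_eigenvector_of_isParabolic ht₀par
  obtain ⟨F, hF⟩ := hFC
  obtain ⟨A, hA⟩ := exists_sl_mulVec_eq v₀ hv₀
  -- the stabiliser `S̃ ≤ Ñ` of the cusp line `ℝ v₀`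
  let St : Subgroup SL(2, ℝ) :=
    { carrier := {s | s ∈ Nt ∧ ∃ c : ℝ, (s : Matrix (Fin 2) (Fin 2) ℝ) *ᵥ v₀ = c • v₀}
      mul_mem' := fun {s s'} hs hs' => by
        obtain ⟨hsN, c, hc⟩ := hs
        obtain ⟨hs'N, c', hc'⟩ := hs'
        refine ⟨Nt.mul_mem hsN hs'N, c' * c, ?_⟩
        rw [Matrix.SpecialLinearGroup.coe_mul, ← Matrix.mulVec_mulVec, hc', Matrix.mulVec_smul, hc,
          smul_smul]
      one_mem' := ⟨Nt.one_mem, 1, by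
        rw [Matrix.SpecialLinearGroup.coe_one, Matrix.one_mulVec, one_smul]⟩
      inv_mem' := fun {s} hs => by
        obtain ⟨hsN, c, hc⟩ := hs
        have hc0 : c ≠ 0 := by
          rintro rfl
          rw [zero_smul] at hc
          exact mulVec_ne_zero s hv₀ hc
        refine ⟨Nt.inv_mem hsN, c⁻¹, ?_⟩
        have h1 := inv_mulVec_mulVec s v₀
        rw [hc, Matrix.mulVec_smul] at h1
        conv_rhs => rw [← h1]
        rw [smul_smul, inv_mul_cancel₀ hc0, one_smul] }
  have hStmem : ∀ s, s ∈ St ↔ s ∈ Nt ∧ ∃ c : ℝ, (s : Matrix (Fin 2) (Fin 2) ℝ) *ᵥ v₀ = c • v₀ :=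
    fun s => Iff.rfl
  have hSt_le : St ≤ Nt := fun s hs => ((hStmem s).mp hs).1
  have ht₀St : t₀ ∈ St := (hStmem t₀).mpr ⟨hGN ht₀G, c₀, hc₀⟩
  -- conjugate `v₀` to `e₁`: `D = A⁻¹ S̃ A` is discrete and upper triangular
  let D : Subgroup SL(2, ℝ) := St.comap (MulAut.conj A).toMonoidHom
  have hDmem : ∀ x, x ∈ D ↔ A * x * A⁻¹ ∈ St := fun x => Iff.rfl
  haveI : DiscreteTopology D := by
    refine DiscreteTopology.of_continuous_injective
      (f := fun x : D => (⟨A * x * A⁻¹, hSt_le ((hDmem x).mp x.2)⟩ : Nt)) ?_ ?_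
    · exact Continuous.subtype_mk (by fun_prop) _
    · intro x y hxy
      apply Subtype.ext
      have := congrArg Subtype.val hxy
      simpa using this
  have hD : ∀ d ∈ D, (d : Matrix (Fin 2) (Fin 2) ℝ) 1 0 = 0 := by
    intro d hd
    obtain ⟨-, c, hc⟩ := (hStmem _).mp ((hDmem d).mp hd)
    have : d = A⁻¹ * (A * d * A⁻¹) * A := by group
    rw [this]
    exact (conj_upper_of_mulVec_eq A _ hA hc).1
  set u : SL(2, ℝ) := A⁻¹ * t₀ * A with hu
  have hAuA : A * u * A⁻¹ = t₀ := by rw [hu]; group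
  have huD : u ∈ D := by rw [hDmem, hAuA]; exact ht₀St
  have hupar : (u : Matrix (Fin 2) (Fin 2) ℝ).IsParabolic := by
    have := isParabolic_conj_sl A⁻¹ t₀ ht₀par
    rwa [inv_inv] at this
  haveI := finiteIndex_zpowers_of_upperTriangular_discrete_of_isParabolic D hD huD hupar
  -- finitely many cosets of `S̃ ∩ Γ̃` in `S̃`: representatives `A q̄ A⁻¹`, `q ∈ D/⟨u⟩`
  haveI : Finite (D ⧸ (Subgroup.zpowers u).subgroupOf D) := Subgroup.finite_quotient_of_finiteIndex
  have hzp : ∀ z ∈ Subgroup.zpowers u, A * z * A⁻¹ ∈ Gt := by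
    intro z hz
    have hle : Subgroup.zpowers u ≤ Gt.comap (MulAut.conj A).toMonoidHom := by
      rw [Subgroup.zpowers_le]
      change A * u * A⁻¹ ∈ Gt
      rw [hAuA]
      exact ht₀G
    exact hle hz
  have hrep : ∀ s ∈ St, ∃ q : D ⧸ (Subgroup.zpowers u).subgroupOf D,
      (A * ((Quotient.out q : D) : SL(2, ℝ)) * A⁻¹)⁻¹ * s ∈ Gt := by
    intro s hs
    have hd : A⁻¹ * s * A ∈ D := by
      rw [hDmem]
      have : A * (A⁻¹ * s * A) * A⁻¹ = s := by group
      rw [this]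
      exact hs
    refine ⟨QuotientGroup.mk ⟨_, hd⟩, ?_⟩
    obtain ⟨z, hz⟩ := QuotientGroup.mk_out_eq_mul ((Subgroup.zpowers u).subgroupOf D) (⟨A⁻¹ * s * A, hd⟩ : D)
    have hzG : A * (((z : D)) : SL(2, ℝ)) * A⁻¹ ∈ Gt :=
      hzp _ (by have := z.2; rw [Subgroup.mem_subgroupOf] at this; exact this)
    rw [hz, Subgroup.coe_mul]
    have : (A * (((⟨A⁻¹ * s * A, hd⟩ : D) : SL(2, ℝ)) * ((z : D) : SL(2, ℝ))) * A⁻¹)⁻¹ * s =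
        (A * ((z : D) : SL(2, ℝ)) * A⁻¹)⁻¹ := by
      change (A * ((A⁻¹ * s * A) * ((z : D) : SL(2, ℝ))) * A⁻¹)⁻¹ * s = _
      group
    rw [this]
    exact Gt.inv_mem hzG
  -- orbit representatives `m_w`, `w ∈ F`
  let msel : (Fin 2 → ℝ) → SL(2, ℝ) := fun w =>
    if h : ∃ m : SL(2, ℝ), m ∈ Nt ∧ ∃ c : ℝ, (m : Matrix (Fin 2) (Fin 2) ℝ) *ᵥ v₀ = c • w
    then h.choose else 1
  have hmselN : ∀ w, msel w ∈ Nt := by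
    intro w
    by_cases h : ∃ m : SL(2, ℝ), m ∈ Nt ∧ ∃ c : ℝ, (m : Matrix (Fin 2) (Fin 2) ℝ) *ᵥ v₀ = c • w
    · simp only [msel, dif_pos h]
      exact h.choose_spec.1
    · simp only [msel, dif_neg h]
      exact Nt.one_mem
  have hmsel : ∀ w, (∃ m : SL(2, ℝ), m ∈ Nt ∧ ∃ c : ℝ, (m : Matrix (Fin 2) (Fin 2) ℝ) *ᵥ v₀ = c • w) →
      ∃ c : ℝ, (msel w : Matrix (Fin 2) (Fin 2) ℝ) *ᵥ v₀ = c • w := by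
    intro w h
    simp only [msel, dif_pos h]
    exact h.choose_spec.2
  -- every `n ∈ Ñ` lies in `m_w · (A q̄ A⁻¹) · Γ̃`
  have hmain : ∀ n ∈ Nt, ∃ w : F, ∃ q : D ⧸ (Subgroup.zpowers u).subgroupOf D,
      (msel (w : Fin 2 → ℝ) * (A * ((Quotient.out q : D) : SL(2, ℝ)) * A⁻¹))⁻¹ * n ∈ Gt := by
    intro n hn
    -- `n v₀` is a cusp vector: an eigenvector of the parabolic `n t₀ n⁻¹ ∈ Γ̃`
    have hpar' : ((n * t₀ * n⁻¹ : SL(2, ℝ)) : Matrix (Fin 2) (Fin 2) ℝ).IsParabolic :=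
      isParabolic_conj_sl n t₀ ht₀par
    have hmem' : n * t₀ * n⁻¹ ∈ Gt := by
      have := hnorm n⁻¹ (Nt.inv_mem hn) t₀ ht₀G
      rwa [inv_inv] at this
    have hev := conj_mulVec_eq n t₀ hc₀
    have hnv : (n : Matrix (Fin 2) (Fin 2) ℝ) *ᵥ v₀ ≠ 0 := mulVec_ne_zero n hv₀
    obtain ⟨g, hg, w, hwF, c, hgc⟩ := hF (n * t₀ * n⁻¹) ((hGtmem _).mp hmem') hpar' _ hnv ⟨c₀, hev⟩
    have hgG : g ∈ Gt := (hGtmem g).mpr hg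
    -- `g n` moves `ℝ v₀` to `ℝ w`, as does `m_w`; so `m_w⁻¹ g n ∈ S̃`
    have hgn : ((g * n : SL(2, ℝ)) : Matrix (Fin 2) (Fin 2) ℝ) *ᵥ v₀ = c • w := by
      rw [Matrix.SpecialLinearGroup.coe_mul, ← Matrix.mulVec_mulVec]
      exact hgc
    obtain ⟨cw, hcw⟩ := hmsel w ⟨g * n, Nt.mul_mem (hGN hgG) hn, c, hgn⟩
    have hcw0 : cw ≠ 0 := by
      rintro rfl
      rw [zero_smul] at hcw
      exact mulVec_ne_zero _ hv₀ hcw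
    have hsSt : (msel w)⁻¹ * (g * n) ∈ St := by
      refine (hStmem _).mpr ⟨Nt.mul_mem (Nt.inv_mem (hmselN w)) (Nt.mul_mem (hGN hgG) hn), c * cw⁻¹, ?_⟩
      rw [Matrix.SpecialLinearGroup.coe_mul, ← Matrix.mulVec_mulVec, hgn, Matrix.mulVec_smul]
      have h1 := inv_mulVec_mulVec (msel w) v₀
      rw [hcw, Matrix.mulVec_smul] at h1
      have h2 : (((msel w)⁻¹ : SL(2, ℝ)) : Matrix (Fin 2) (Fin 2) ℝ) *ᵥ w = cw⁻¹ • v₀ := by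
        rw [← h1, smul_smul, inv_mul_cancel₀ hcw0, one_smul]
      rw [h2, smul_smul]
    obtain ⟨q, hq⟩ := hrep _ hsSt
    refine ⟨⟨w, hwF⟩, q, ?_⟩
    have hrN : A * ((Quotient.out q : D) : SL(2, ℝ)) * A⁻¹ ∈ Nt :=
      hSt_le ((hDmem _).mp (Quotient.out q : D).2)
    have hmrN : msel w * (A * ((Quotient.out q : D) : SL(2, ℝ)) * A⁻¹) ∈ Nt :=
      Nt.mul_mem (hmselN w) hrN
    have hconj := hnorm _ hmrN g⁻¹ (Gt.inv_mem hgG)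
    have := Gt.mul_mem hconj hq
    convert this using 1
    group
  -- hence `N/Γ̄` is finite
  haveI : Finite (N ⧸ Γ.subgroupOf N) := by
    let f : F × (D ⧸ (Subgroup.zpowers u).subgroupOf D) → N ⧸ Γ.subgroupOf N := fun p =>
      QuotientGroup.mk ⟨π (msel (p.1 : Fin 2 → ℝ) * (A * ((Quotient.out p.2 : D) : SL(2, ℝ)) * A⁻¹)),
        (hNtmem _).mp (Nt.mul_mem (hmselN _) (hSt_le ((hDmem _).mp (Quotient.out p.2 : D).2)))⟩
    refine Finite.of_surjective f fun x => ?_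
    obtain ⟨nbar, rfl⟩ := QuotientGroup.mk_surjective x
    obtain ⟨nt, hnt⟩ := QuotientGroup.mk_surjective (nbar : PSL2R)
    have hntN : nt ∈ Nt := by
      rw [hNtmem, show π nt = (nbar : PSL2R) from hnt]
      exact nbar.2
    obtain ⟨w, q, hwq⟩ := hmain nt hntN
    refine ⟨(w, q), ?_⟩
    apply QuotientGroup.eq.mpr
    rw [Subgroup.mem_subgroupOf]
    change (π (msel (w : Fin 2 → ℝ) * (A * ((Quotient.out q : D) : SL(2, ℝ)) * A⁻¹)))⁻¹ *
      (nbar : PSL2R) ∈ Γ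
    rw [← show π nt = (nbar : PSL2R) from hnt, ← map_inv, ← map_mul]
    exact (hGtmem _).mp hwq
  exact Subgroup.finiteIndex_of_finite_quotient

end HolRS

end Literature.AnabelianGeometry.AbsoluteAnabelian

end
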